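/-
Copyright (c) 2026. All rights reserved.
Released under Apache 2.0 license as described in the file LICENSE.
Authors: abc-iut cell, statement-typer seat abc-iut-L4-t3 (wave 1).
-/
import Mathlib.NumberTheory.NumberField.InfinitePlace.Basic
import Mathlib.RingTheory.DedekindDomain.AdicValuation
import Mathlib.Algebra.Ring.Action.Basic
import Literature.AnabelianGeometry.AbsoluteAnabelian.FundamentalExtension
import Literature.AnabelianGeometry.AbsoluteAnabelian.ProfiniteTerminology
import HarnessLib

/-!
# [AbsTopIII] Definition 5.1 (i)–(iii), Remark 5.1.1, Corollary 5.2 (i): global Galois-theaters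

S. Mochizuki, *Topics in absolute anabelian geometry III: global reconstruction algorithms*,
J. Math. Sci. Univ. Tokyo 22 (2015) 939–1156 [MochizukiAbsTopIII2015]; locators `p.N` are pages of the
author's manuscript (lit key `paper:url-5493eb38cbb7`, 164 pp; journal pagination not held), read on
the page: Def 5.1 (i) p. 113, (ii) pp. 113–115, (iii) pp. 115–116; Rmk 5.1.1 p. 118; Cor 5.2 (i) p. 119.

## What is typed and how (statements-first, D-0014; layer policy plan/L4/ASSIGNMENTS.md §2)

* Def 5.1 (i): `V(F)`, `V⊚(F) = V(F) ∪ {⊚_F}` for a number field `F` as REAL definitions over Mathlib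
  (`NumberField.InfinitePlace F ⊕ HeightOneSpectrum (𝓞 F)`, the generic prime as `none`); the pro-sets
  `V(F̄/F)`, `V⊚(F̄/F)` "equipped with a continuous action" and their decomposition into the global
  element and archimedean/nonarchimedean local elements are typed by the structure `GaloisProSet`
  (a topological `Π`-set with a fixed global point and a stable decomposition).
* Def 5.1 (ii) = the objects "functorially constructed from `Π_X`" by Thm 1.9, Cor 2.8, 2.9 (owners
  abc-iut-L4-t1, -t2): `Δ_X`, `k_NF(Π_X) ≅ F̄`, `V⊚(Π_X)`, `Π_{X,v}`, `X(Π_X, v)`, `δ_{ell,v}`, `κ_{ell,v}` —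
  DEEP INPUTS, typed as the fields of ONE interface structure `GlobalAnabelianContext` indexed (row-41
  policy) by the abstract extension `Π ↠ G` (t1's `FundamentalExtension`), never by the curve; each field
  quotes its sentence (TODO-merge abc-iut-L4-t1, -t2). `Ob(EA⊚)` is the predicate `IsAdmissible`
  (owner of `IsEllipticallyAdmissible`: abc-iut-L4-t4).
* Def 5.1 (iii): `GlobalGaloisTheater` and its morphisms, with the reference isomorphism `ψ_V` as an
  `∃` over an explicit predicate `IsReferenceIso`; `Π_v` for nonarchimedean `v` is DERIVED as the
  stabiliser, exactly as printed. Outer isomorphisms `δ_v` are recorded by a representative; every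
  condition is stated up to inner automorphism (`InnerCompatible`).
* Rmk 5.1.1 (uniqueness of `ψ_V`, `ψ_v`, `φ_V`, `φ_v`) and Cor 5.2 (i) (the forgetful functor
  `An⊚[Th⊚] → Th⊚` is an equivalence) as NAMED `Prop` FACTS over a context.

NOT here: Def 5.1 (iv)–(vi), Cor 5.2 (ii)–(vii) (`PanalocalTheaters.lean`, `TPairs.lean`), `V(K)`, `V⊚(Π_X)/Aut`, `d_v^mod`. Nothing here bears on [IUTchIII] Cor. 3.12.
-/

set_option autoImplicit false

universe u

open CategoryTheory Topology

namespace Literature.AnabelianGeometry.AbsoluteAnabelian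

/-! ## Def 5.1 (i): valuations of a number field, the generic prime -/

section NumberFieldValuations

open NumberField IsDedekindDomain

variable (F : Type*) [Field F] [NumberField F]

/-- `V(F)`: the set of archimedean and nonarchimedean valuations (places) of the number field `F`
(Mathlib: infinite places `⊕` nonzero primes of `𝓞_F`). [cite: MochizukiAbsTopIII2015, Def 5.1 (i) p. 113] -/
def Valuations : Type _ := InfinitePlace F ⊕ HeightOneSpectrum (𝓞 F)

/-- `V⊚(F) := V(F) ∪ {⊚_F}`, where `⊚_F` "is to be thought of as representing the global field `F`, or,
alternatively, the generic prime of `F`" (`none`). [cite: MochizukiAbsTopIII2015, Def 5.1 (i) p. 113] -/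
def ValuationsGen : Type _ := Option (Valuations F)

variable {F}

/-- the generic prime `⊚_F ∈ V⊚(F)`. [cite: MochizukiAbsTopIII2015, Def 5.1 (i) p. 113] -/
def ValuationsGen.generic : ValuationsGen F := none

/-- `v ∈ V(F)` is archimedean (`V(F) = V(F)^arc ∪ V(F)^non`). [cite: MochizukiAbsTopIII2015, Def 5.1 (i) p. 113] -/
def Valuations.IsArchimedean (v : Valuations F) : Prop := v.isLeft

end NumberFieldValuations

/-! ## Pro-sets of valuations with Galois action (Def 5.1 (i), (iii)) -/

/-- A pro-set `V̄⊚` "equipped with a continuous action by `Π` that decomposes into a disjoint union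
`V̄⊚ = {⊚_V̄} ∪ V̄^non ∪ V̄^arc`" (Def 5.1 (iii)); the model case is `V⊚(F̄/F) = lim V⊚(K)` with its
`Gal(F̄/F)`-action, unique global element `⊚_F̄` and archimedean/nonarchimedean local elements
(Def 5.1 (i)). The topology records the pro-structure. [cite: MochizukiAbsTopIII2015, Def 5.1 (i) p. 113] -/
structure GaloisProSet (P : Type u) [Group P] [TopologicalSpace P] : Type (u + 1) where
  /-- the underlying (pro-)set -/
  carrier : Type u
  /-- its (pro-)topology -/
  [top : TopologicalSpace carrier]
  /-- the action of `Π` -/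
  [action : MulAction P carrier]
  /-- the action is continuous -/
  [continuousSMul : ContinuousSMul P carrier]
  /-- points are closed (pro-sets are Hausdorff) -/
  [t1 : T1Space carrier]
  /-- the global element `⊚` -/
  generic : carrier
  /-- the nonarchimedean local elements -/
  non : Set carrier
  /-- the archimedean local elements -/
  arc : Set carrier
  /-- `⊚` is fixed by `Π` ("the inverse system of `⊚_K`'s determines a unique global element") -/
  smul_generic : ∀ g : P, g • generic = generic
  /-- `⊚ ∉ V̄^non` -/
  generic_notMem_non : generic ∉ non
  /-- `⊚ ∉ V̄^arc` -/
  generic_notMem_arc : generic ∉ arc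
  /-- `V̄^non ∩ V̄^arc = ∅` -/
  disjoint_non_arc : Disjoint non arc
  /-- `V̄⊚ = {⊚} ∪ V̄^non ∪ V̄^arc` -/
  eq_generic_or_mem (v : carrier) : v = generic ∨ v ∈ non ∨ v ∈ arc
  /-- `V̄^non` is `Π`-stable -/
  smul_mem_non : ∀ (g : P) {v : carrier}, v ∈ non → g • v ∈ non
  /-- `V̄^arc` is `Π`-stable -/
  smul_mem_arc : ∀ (g : P) {v : carrier}, v ∈ arc → g • v ∈ arc

attribute [instance] GaloisProSet.top GaloisProSet.action GaloisProSet.continuousSMul GaloisProSet.t1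

namespace GaloisProSet

variable {P : Type u} [Group P] [TopologicalSpace P] (V : GaloisProSet P)

/-- for `v ∈ V̄^non`, the decomposition group `Π_v ⊆ Π`: "the closed subgroup of elements that fix `v`"
(the stabiliser). [cite: MochizukiAbsTopIII2015, Def 5.1 (iii) p. 115] -/
def decomp (v : V.carrier) : Subgroup P := MulAction.stabilizer P v

/-- `Π_v` is closed ("the closed subgroup …"). [cite: MochizukiAbsTopIII2015, Def 5.1 (iii) p. 115] -/
theorem isClosed_decomp (v : V.carrier) : IsClosed (V.decomp v : Set P) := by
  rw [show (V.decomp v : Set P) = (fun g : P => g • v) ⁻¹' {v} by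
    ext g; simp [decomp, MulAction.mem_stabilizer_iff]]
  exact isClosed_singleton.preimage (continuous_id.smul continuous_const)

/-- `Π_v` as a profinite group in its own right (an object of `TG`). [cite: MochizukiAbsTopIII2015, Def 5.1 (iv) p. 116] -/
noncomputable def decompGrp {P : ProfiniteGrp.{u}} (V : GaloisProSet P) (v : V.carrier) : ProfiniteGrp.{u} :=
  ProfiniteGrp.ofClosedSubgroup ⟨V.decomp v, V.isClosed_decomp v⟩

end GaloisProSet

/-! ## Stubs for the §2 / §1 inputs (TODO-merge abc-iut-L4-t2, abc-iut-L4-t1) -/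

/-- STUB for an object of `EA` / `Orb(EA)` (Def 2.1, Def 4.1 (iii): Aut-holomorphic orbispaces — owner
abc-iut-L4-t2) with the two pieces of structure §5 uses: the topological field `A_X` of Cor 2.9 and the
profinite completion `π₁(X)^∧` of the topological fundamental group (target of `δ_v`, Def 5.1 (ii)).
TODO-merge abc-iut-L4-t2. [cite: MochizukiAbsTopIII2015, Def 5.1 (ii) p. 114] -/
structure AutHolOrbispace : Type (u + 1) where
  /-- underlying topological (orbi)space -/
  carrier : Type u
  /-- its topology -/
  [top : TopologicalSpace carrier]
  /-- the field `A_X` (`≅ ℂ`) functorially attached to `X` (Cor 2.9) -/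
  fieldA : Type u
  /-- `A_X` is a field -/
  [instField : Field fieldA]
  /-- `A_X` is a topological field -/
  [topA : TopologicalSpace fieldA]
  /-- `π₁(X)^∧`, the profinite completion of the topological fundamental group -/
  pi1Hat : ProfiniteGrp.{u}

attribute [instance] AutHolOrbispace.top AutHolOrbispace.instField AutHolOrbispace.topA

/-- STUB: an isomorphism of Aut-holomorphic orbispaces together with what it induces on `A_X` (Cor 2.9
functoriality) and on `π₁^∧` (a representative of the induced outer isomorphism). TODO-merge abc-iut-L4-t2.
G1 repair (audit abc-iut-L6-t22): every `∃ ψ_v`/`∃ φ_v` clause below also demands `IsHomeomorph ψ_v.fieldIso`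
(`A_X ≅ A_Y` as TOPOLOGICAL fields; with `κ_v = ψ_v ∘ κ_{ell,v}`, dense image, this pins `fieldIso` in the
intended model); the δ-rigidity of `ψ_v` (Rmk 5.1.1 via Cor 2.3 (i)) stays DEFERRED to the t2 merge, where
`toHomeomorph` must be Aut-holomorphic and INDUCE `fieldIso`, `pi1Iso`; until that merge the inherited sites `TPairs.IsTPairReferenceFor`/
`TPairs.Hom.φarc_kummer`/`PanalocalTheaters` (`Nonempty (Iso …)`, `xClass_iso`) are STUB-WEAK (G1/T2). [cite: MochizukiAbsTopIII2015, Def 5.1 (iii) p. 115] -/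
structure AutHolOrbispace.Iso (X Y : AutHolOrbispace.{u}) : Type u where
  /-- the underlying homeomorphism -/
  toHomeomorph : X.carrier ≃ₜ Y.carrier
  /-- the induced isomorphism `A_X ≅ A_Y` of fields -/
  fieldIso : X.fieldA ≃+* Y.fieldA
  /-- a representative of the induced outer isomorphism `π₁(X)^∧ ≅ π₁(Y)^∧` -/
  pi1Iso : X.pi1Hat ≃ₜ* Y.pi1Hat

/-- Two continuous isomorphisms into the same profinite group agree *up to an inner automorphism of the
target* — how we express conditions on OUTER isomorphisms recorded by representatives.
[cite: MochizukiAbsTopIII2015, Def 5.1 (ii) p. 114] -/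
def InnerCompatible {A B C : Type u} [Group C] (f : A → C) (g : B → C) (e : A → B) : Prop :=
  ∃ c : C, ∀ a : A, g (e a) = c * f a * c⁻¹

/-- "the maximal topologically finitely generated closed normal subgroup of `Π_X`" — the group-theoretic
characterisation of `Δ_X` quoted in Def 5.1 (ii) from [Mzk9] Lemma 1.1.4 (i), as a property of a subgroup.
[cite: MochizukiAbsTopIII2015, Def 5.1 (ii) p. 113] -/
structure IsMaxTopFGClosedNormal {P : Type u} [Group P] [TopologicalSpace P] [IsTopologicalGroup P]
    (D : Subgroup P) : Prop where
  /-- `Δ` is normal -/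
  normal : D.Normal
  /-- `Δ` is closed -/
  isClosed : IsClosed (D : Set P)
  /-- `Δ` is topologically finitely generated -/
  topFG : IsTopologicallyFinitelyGenerated D
  /-- every topologically finitely generated closed normal subgroup lies in `Δ` -/
  maximal : ∀ N : Subgroup P, N.Normal → IsClosed (N : Set P) → IsTopologicallyFinitelyGenerated N → N ≤ D

/-- A morphism of `EA⊚` between (admissible) extensions `Π₁ ↠ G₁`, `Π₂ ↠ G₂`: "open injections of
profinite groups that induce isomorphisms between the respective maximal topologically finitely generated
closed normal subgroups [i.e., the respective `Δ`]", as a property of a morphism of t1's category of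
extensions: t1's `Hom.IsBaseChange` (`Δ₁ ≅ Δ₂`) plus open injectivity of the `Π`-component (the `G`-component is
then an open injection too, `aug` being surjective). [cite: MochizukiAbsTopIII2015, Def 5.1 (iii) p. 115] -/
structure IsEAHom {E₁ E₂ : FundamentalExtension.{u}} (f : E₁ ⟶ E₂) : Prop
    extends FundamentalExtension.Hom.IsBaseChange f where
  /-- `Π₁ ↪ Π₂` is injective -/
  injective : Function.Injective f.arith
  /-- with open image -/
  isOpen_range : IsOpen (Set.range f.arith)

/-! ## Def 5.1 (ii) as an interface: the objects functorially constructed from `Π` -/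

/-- INTERFACE (deep input; TODO-merge abc-iut-L4-t1 Thm 1.9 / Cor 1.10 / Cor 2.8, abc-iut-L4-t2 Cor 2.9,
abc-iut-L4-t4 `IsEllipticallyAdmissible`): the data of Def 5.1 (ii) "functorially constructed from `Π_X`",
indexed — per the layer's row-41 policy — by the ABSTRACT extension `Π ↠ G` (t1's `FundamentalExtension`),
never by the curve. Fields are total in `E`; they are meaningful on `IsAdmissible E` = `Ob(EA⊚)` =
"profinite groups isomorphic to `Π_X` for some `X` as in (ii)" (elliptically admissible hyperbolic orbicurve
over a totally imaginary number field, with the surjectivity/field-of-moduli assumption of p. 114).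
[cite: MochizukiAbsTopIII2015, Def 5.1 (ii) p. 114] -/
structure GlobalAnabelianContext : Type (u + 1) where
  /-- `Ob(EA⊚)`: "profinite groups isomorphic to `Π_X` for some `X` as in (ii)" -/
  IsAdmissible : FundamentalExtension.{u} → Prop
  /-- `Ob(EA⊚)` is isomorphism-closed -/
  isAdmissible_of_iso : ∀ {E₁ E₂ : FundamentalExtension.{u}}, Nonempty (E₁ ≅ E₂) →
    IsAdmissible E₁ → IsAdmissible E₂
  /-- "`Δ_X ⊆ Π_X` … may be characterized group-theoretically as the maximal topologically finitely
  generated closed normal subgroup" ([Mzk9] Lemma 1.1.4 (i)) -/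
  geom_isMax : ∀ E, IsAdmissible E → IsMaxTopFGClosedNormal E.geom
  /-- `k_NF(Π)`: "one may functorially construct `F̄` from `Π_X` as the field `k^×_NF ∪ {0}` constructed in
  Theorem 1.9 (e)" -/
  kNF : FundamentalExtension.{u} → Type u
  /-- `k_NF(Π)` is a field -/
  [instField : ∀ E, Field (kNF E)]
  /-- with its natural action of `Π` by field automorphisms -/
  [instAction : ∀ E, MulSemiringAction E.arith (kNF E)]
  /-- `V⊚(Π)` with its `Π`-action: "by considering valuations on the field `k_NF(Π_X)` one may functorially
  construct `V⊚(F̄/F)`, `V(F̄/F)` from `Π_X`" -/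
  proVal : (E : FundamentalExtension.{u}) → GaloisProSet E.arith
  /-- `X(Π, v)` for archimedean `v`: the Aut-holomorphic orbispace `X_{ell,v}` of Cor 2.8 "regarded as an
  object constructed from `Π_X`" -/
  archSpace : (E : FundamentalExtension.{u}) → (proVal E).arc → AutHolOrbispace.{u}
  /-- `δ_{ell,v} : Δ_X ≅ π₁(X_{ell,v})^∧`, "the natural outer isomorphism" (a representative) -/
  δell : (E : FundamentalExtension.{u}) → (v : (proVal E).arc) → E.geom ≃ₜ* (archSpace E v).pi1Hat
  /-- `κ_{ell,v} : k_NF(Π_X) ↪ A_{X_{ell,v}}`, "the natural inclusion of fields" (Cor 2.9 (b)) -/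
  κell : (E : FundamentalExtension.{u}) → (v : (proVal E).arc) → kNF E →+* (archSpace E v).fieldA
  /-- functoriality of `V⊚(−)` in morphisms of `EA⊚` (an isomorphism of pro-sets, cf. (iii)) -/
  mapProVal : ∀ {E₁ E₂ : FundamentalExtension.{u}} (f : E₁ ⟶ E₂), IsEAHom f →
    (proVal E₁).carrier ≃ₜ (proVal E₂).carrier
  /-- `V⊚(f)` is equivariant along `Π₁ ↪ Π₂` -/
  mapProVal_smul : ∀ {E₁ E₂ : FundamentalExtension.{u}} (f : E₁ ⟶ E₂) (hf : IsEAHom f)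
    (g : E₁.arith) (v : (proVal E₁).carrier), mapProVal f hf (g • v) = f.arith g • mapProVal f hf v
  /-- functoriality of `k_NF(−)` in morphisms of `EA⊚` (`k_NF(Π₁) ≅ k_NF(Π₂) ≅ F̄`) -/
  mapKNF : ∀ {E₁ E₂ : FundamentalExtension.{u}} (f : E₁ ⟶ E₂), IsEAHom f → kNF E₁ ≃+* kNF E₂

attribute [instance] GlobalAnabelianContext.instField GlobalAnabelianContext.instAction

/-! ## Def 5.1 (iii): global Galois-theaters -/

/-- Conditions (a), (b) of Def 5.1 (iii) on a candidate reference isomorphism `ψ : V⊚(Π) ≅ V̄⊚` for data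
`(Π ↷ V̄⊚, {X_v, δ_v, κ_v}_{v ∈ V̄^arc})`: (a) `ψ` is `Π`-equivariant and maps `⊚ ↦ ⊚`, `non ↦ non`,
`arc ↦ arc`; (b) for `v_ell ↦ v ∈ V̄^arc` there is an isomorphism `ψ_v : X(Π, v_ell) ≅ X_v` compatible with
`δ_{ell,v_ell}, δ_v` (up to inner automorphism) and with `κ_{ell,v_ell}, κ_v`, bicontinuous on `A` (G1).
[cite: MochizukiAbsTopIII2015, Def 5.1 (iii) p. 115] -/
def IsReferenceIsoFor (R : GlobalAnabelianContext.{u}) (E : FundamentalExtension.{u})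
    (V : GaloisProSet E.arith) (X : V.arc → AutHolOrbispace.{u})
    (δ : (v : V.arc) → E.geom ≃ₜ* (X v).pi1Hat) (κ : (v : V.arc) → R.kNF E →+* (X v).fieldA)
    (ψ : (R.proVal E).carrier ≃ₜ V.carrier) : Prop :=
  (∀ (g : E.arith) (v : (R.proVal E).carrier), ψ (g • v) = g • ψ v) ∧
    ψ (R.proVal E).generic = V.generic ∧ ψ '' (R.proVal E).non = V.non ∧ ψ '' (R.proVal E).arc = V.arc ∧
    ∀ (v : (R.proVal E).arc) (hv : ψ v ∈ V.arc),
      ∃ ψv : AutHolOrbispace.Iso (R.archSpace E v) (X ⟨ψ v, hv⟩), IsHomeomorph ψv.fieldIso ∧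
        InnerCompatible (fun a => ψv.pi1Iso (R.δell E v a)) (δ ⟨ψ v, hv⟩) id ∧
        ∀ x : R.kNF E, κ ⟨ψ v, hv⟩ x = ψv.fieldIso (R.κell E v x)

/-- A **global Galois-theater** `V⊚ = (Π ↷ V̄⊚, {Π_v}_{v ∈ V̄^non}, {(X_v, δ_v, κ_v)}_{v ∈ V̄^arc})`:
`Π ∈ Ob(EA⊚)` (the *global Galois group* of the theater); `V̄⊚` a pro-set with continuous `Π`-action
decomposing as `{⊚} ∪ V̄^non ∪ V̄^arc`; `Π_v` (for `v ∈ V̄^non`) IS the stabiliser (derived: `decomp`);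
for `v ∈ V̄^arc`, `X_v` an Aut-holomorphic orbispace, `δ_v : Δ ≅ π₁(X_v)^∧` an outer isomorphism (we record
a representative), `κ_v : k_NF(Π) ↪ A_{X_v}` an inclusion of fields — such that a reference isomorphism
`ψ_V : V⊚(Π) ≅ V̄⊚` satisfying (a), (b) EXISTS (it is then unique, Rmk 5.1.1).
[cite: MochizukiAbsTopIII2015, Def 5.1 (iii) p. 115] -/
structure GlobalGaloisTheater (R : GlobalAnabelianContext.{u}) : Type (u + 1) where
  /-- the global Galois group `Π` (with its quotient `G`), an object of `EA⊚` -/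
  ext : FundamentalExtension.{u}
  /-- `Π ∈ Ob(EA⊚)` -/
  isAdmissible : R.IsAdmissible ext
  /-- `Π ↷ V̄⊚` -/
  V : GaloisProSet ext.arith
  /-- `X_v`, `v ∈ V̄^arc` -/
  X : V.arc → AutHolOrbispace.{u}
  /-- `δ_v : Δ ≅ π₁(X_v)^∧` (representative of the outer isomorphism) -/
  δ : (v : V.arc) → ext.geom ≃ₜ* (X v).pi1Hat
  /-- `κ_v : k_NF(Π) ↪ A_{X_v}` -/
  κ : (v : V.arc) → R.kNF ext →+* (X v).fieldA
  /-- existence of a reference isomorphism `ψ_V : V⊚(Π) ≅ V̄⊚` with (a), (b) -/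
  exists_referenceIso : ∃ ψ : (R.proVal ext).carrier ≃ₜ V.carrier, IsReferenceIsoFor R ext V X δ κ ψ

namespace GlobalGaloisTheater

variable {R : GlobalAnabelianContext.{u}}

/-- the global Galois group `Π` of the theater. [cite: MochizukiAbsTopIII2015, Def 5.1 (iii) p. 115] -/
abbrev grp (T : GlobalGaloisTheater R) : ProfiniteGrp.{u} := T.ext.arith

/-- `Π_v ⊆ Π` for `v ∈ V̄^non` (the stabiliser). [cite: MochizukiAbsTopIII2015, Def 5.1 (iii) p. 115] -/
def decomp (T : GlobalGaloisTheater R) (v : T.V.carrier) : Subgroup T.grp := T.V.decomp v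

/-- "`ψ` is a reference isomorphism for the theater `T`". [cite: MochizukiAbsTopIII2015, Def 5.1 (iii) p. 115] -/
abbrev IsReferenceIso (T : GlobalGaloisTheater R) (ψ : (R.proVal T.ext).carrier ≃ₜ T.V.carrier) : Prop :=
  IsReferenceIsoFor R T.ext T.V T.X T.δ T.κ ψ

/-- A **morphism of global Galois-theaters** `φ : V⊚₁ → V⊚₂`: a morphism `φ_Π : Π₁ ↪ Π₂` of `EA⊚` and an
isomorphism of pro-sets `φ_V : V̄⊚₁ ≅ V̄⊚₂` such that (a) `φ_Π`, `φ_V` are compatible with the actions and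
the decompositions, and (b) for `v₁ ↦ v₂` archimedean there is an isomorphism `φ_v : X_{v₁} ≅ X_{v₂}`
compatible with `δ_{v₁}, δ_{v₂}` (through `Δ₁ ≅ Δ₂`) and with `κ_{v₁}, κ_{v₂}` (through `k_NF(Π₁) ≅ k_NF(Π₂)`).
"(a) implies that for `v₁ ↦ v₂` nonarchimedean, `φ_Π` induces an open injection `Π_{v₁} ↪ Π_{v₂}`."
[cite: MochizukiAbsTopIII2015, Def 5.1 (iii) pp. 115–116] -/
structure Hom (T₁ T₂ : GlobalGaloisTheater R) : Type u where
  /-- `φ_Π : Π₁ ↪ Π₂`, a morphism of `EA⊚` -/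
  φgrp : T₁.ext ⟶ T₂.ext
  /-- `φ_Π` is an open injection inducing `Δ₁ ≅ Δ₂` -/
  isEAHom : IsEAHom φgrp
  /-- `φ_V : V̄⊚₁ ≅ V̄⊚₂`, an isomorphism of pro-sets (a homeomorphism) -/
  φV : T₁.V.carrier ≃ₜ T₂.V.carrier
  /-- (a) compatibility with the actions -/
  φV_smul : ∀ (g : T₁.ext.arith) (v : T₁.V.carrier), φV (g • v) = φgrp.arith g • φV v
  /-- (a) `⊚ ↦ ⊚` -/
  φV_generic : φV T₁.V.generic = T₂.V.generic
  /-- (a) `V̄^non₁ ≅ V̄^non₂` -/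
  image_non : φV '' T₁.V.non = T₂.V.non
  /-- (a) `V̄^arc₁ ≅ V̄^arc₂` -/
  image_arc : φV '' T₁.V.arc = T₂.V.arc
  /-- (b) at archimedean `v₁ ↦ v₂`: an isomorphism `φ_v : X_{v₁} ≅ X_{v₂}` compatible with `δ`'s and `κ`'s -/
  arch_compat : ∀ (v : T₁.V.arc) (hv : φV v ∈ T₂.V.arc),
    ∃ φv : AutHolOrbispace.Iso (T₁.X v) (T₂.X ⟨φV v, hv⟩), IsHomeomorph φv.fieldIso ∧
      InnerCompatible (fun a : T₁.ext.geom => φv.pi1Iso (T₁.δ v a))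
        (T₂.δ ⟨φV v, hv⟩) (fun a => ⟨φgrp.arith a, isEAHom.bijOn_geom.mapsTo a.2⟩) ∧
      ∀ x : R.kNF T₁.ext, T₂.κ ⟨φV v, hv⟩ (R.mapKNF φgrp isEAHom x) = φv.fieldIso (T₁.κ v x)

/-- (a) ⟹ `φ_Π(Π_{v₁}) ⊆ Π_{v₂}` for `v₁ ↦ v₂`. [cite: MochizukiAbsTopIII2015, Def 5.1 (iii) p. 116] -/
theorem Hom.map_decomp_le {T₁ T₂ : GlobalGaloisTheater R} (φ : Hom T₁ T₂) (v : T₁.V.carrier) :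
    (T₁.decomp v).map φ.φgrp.arith.toMonoidHom ≤ T₂.decomp (φ.φV v) := by
  rintro _ ⟨g, hg, rfl⟩
  change g • v = v at hg
  change φ.φgrp.arith g • φ.φV v = φ.φV v
  rw [← φ.φV_smul, hg]

end GlobalGaloisTheater

/-! ## The canonical theater `V⊚(Π)` (Cor 5.2 (i), object map) -/

/-- For the data `V⊚(Π) := (Π ↷ V⊚(Π), {Π_v}, {(X(Π,v), δ_{ell,v}, κ_{ell,v})})` functorially constructed from
`Π ∈ Ob(EA⊚)` (Cor 5.2 (i)), the identity is a reference isomorphism. [cite: MochizukiAbsTopIII2015, Cor 5.2 (i) p. 119] -/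
theorem GlobalAnabelianContext.refl_isReferenceIsoFor (R : GlobalAnabelianContext.{u})
    (E : FundamentalExtension.{u}) :
    IsReferenceIsoFor R E (R.proVal E) (R.archSpace E) (R.δell E) (R.κell E) (Homeomorph.refl _) :=
  ⟨fun _ _ => rfl, rfl, by ext; simp, by ext; simp, fun v hv => by
    obtain ⟨v, hv'⟩ := v
    exact ⟨⟨Homeomorph.refl _, RingEquiv.refl _, ContinuousMulEquiv.refl _⟩, (Homeomorph.refl _).isHomeomorph,
      ⟨1, fun a => by simp only [one_mul, inv_one, mul_one]; rfl⟩, fun x => rfl⟩⟩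

/-- `V⊚(Π)` as a global Galois-theater (reference isomorphism = identity). [cite: MochizukiAbsTopIII2015, Cor 5.2 (i) p. 119] -/
@[reducible] def GlobalAnabelianContext.theater (R : GlobalAnabelianContext.{u}) (E : FundamentalExtension.{u})
    (hE : R.IsAdmissible E) : GlobalGaloisTheater R where
  ext := E
  isAdmissible := hE
  V := R.proVal E
  X := R.archSpace E
  δ := R.δell E
  κ := R.κell E
  exists_referenceIso := ⟨Homeomorph.refl _, R.refl_isReferenceIsoFor E⟩

/-! ## Rmk 5.1.1 and Cor 5.2 (i) as named facts -/

/-- **Remark 5.1.1** (named fact): the reference isomorphism `ψ_V` of a global Galois-theater is UNIQUELY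
determined by conditions (a), (b) ("for nonarchimedean elements … a nonarchimedean prime is uniquely
determined by any open subgroup of its decomposition group [NSW, Cor 12.1.3]; for archimedean elements, by
considering the topology induced on `k_NF(Π)` by `A_{X_v}` via `κ_v`"). An ASSUMPTION on `R`: it holds for the
context of Thm 1.9 / Cor 2.8, not for an arbitrary `R`. [cite: MochizukiAbsTopIII2015, Rmk 5.1.1 p. 118] -/
def ReferenceIsoUnique (R : GlobalAnabelianContext.{u}) : Prop :=
  ∀ (T : GlobalGaloisTheater R) (ψ₁ ψ₂ : (R.proVal T.ext).carrier ≃ₜ T.V.carrier),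
    T.IsReferenceIso ψ₁ → T.IsReferenceIso ψ₂ → ψ₁ = ψ₂

/-- **Remark 5.1.1, last sentence** (named fact; an assumption on `R`, true for the context of Thm 1.9 / Cor 2.8):
in a morphism of global Galois-theaters, `φ_V` is uniquely determined by `φ_Π`. [cite: MochizukiAbsTopIII2015, Rmk 5.1.1 p. 118] -/
def TheaterHomDeterminedByGroupHom (R : GlobalAnabelianContext.{u}) : Prop :=
  ∀ (T₁ T₂ : GlobalGaloisTheater R) (φ φ' : GlobalGaloisTheater.Hom T₁ T₂), φ.φgrp = φ'.φgrp → φ.φV = φ'.φV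

/-- **Corollary 5.2 (i)** (named fact), essential-surjectivity half of "`An⊚[Th⊚] → Th⊚` is an equivalence": every global Galois-theater with global Galois group `Π` is isomorphic, by a morphism of theaters lying over
the identity of `Π`, to the canonical theater `V⊚(Π)` (an assumption on `R`, true for the context of Thm 1.9 /
Cor 2.8). [cite: MochizukiAbsTopIII2015, Cor 5.2 (i) p. 119] -/
def TheaterIsoCanonical (R : GlobalAnabelianContext.{u}) : Prop :=
  ∀ T : GlobalGaloisTheater R,
    ∃ φ : GlobalGaloisTheater.Hom (R.theater T.ext T.isAdmissible) T, φ.φgrp = 𝟙 T.ext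

/-- **Corollary 5.2 (i)** (named fact), full-faithfulness half: every morphism of `EA⊚` between the global
Galois groups extends to a morphism of the canonical theaters (uniquely, by Rmk 5.1.1), i.e. the functors
`EA⊚ → An⊚[Th⊚] → Th⊚ → EA⊚` are equivalences whose composite is naturally isomorphic to the identity
(an assumption on `R`, true for the context of Thm 1.9 / Cor 2.8). [cite: MochizukiAbsTopIII2015, Cor 5.2 (i) p. 119] -/
def EAHomExtendsToTheaters (R : GlobalAnabelianContext.{u}) : Prop :=
  ∀ (E₁ E₂ : FundamentalExtension.{u}) (h₁ : R.IsAdmissible E₁) (h₂ : R.IsAdmissible E₂) (f : E₁ ⟶ E₂),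
    IsEAHom f → ∃ φ : GlobalGaloisTheater.Hom (R.theater E₁ h₁) (R.theater E₂ h₂), φ.φgrp = f

end Literature.AnabelianGeometry.AbsoluteAnabelian
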